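import Literature.NumberTheory.EllipticCurves.PlusMinusPAdicLFunctionProofs
import Summits.BirchSwinnertonDyer.BirchSwinnertonDyer.Theorems.ResidualThetaTransportAtTwoPlusDualLayerToolkit
import HarnessLib

/-!
# Kim 2007 Prop. 3.15 — θ-ALGEBRA of the half polynomials: `T·ω̃⁺_n` and `ω̃⁻_n` (and `ω̃⁺_n`, `T·ω̃⁻_n`) are coprime up to an
# explicit power of `p` in `ℤ[T]` (BEZOUT `p^ν ∈ (T·ω̃⁺_n, ω̃⁻_n)`), and all of them are distinguished over `ℤ_p`

Routes `ResidualThetaTransportAtTwo` (RTT, crux r201 `ResidualLambdaFormulaNegDiscAtTwo`, stmt-BirchSwinnertonDyer-23110) /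
`ThetaPartnerAtTwo`. Seat `prover-bsd-wall-tp2-p2x-w3` g13; `--supports stmt-BirchSwinnertonDyer-23110` (θ-algebra of the ISO / H-PLUSDUAL
θ-plan, lead 21:28Z). THEOREMS ONLY (no definition, no named fact, no instance, no `sorry`); PURE POLYNOMIAL ALGEBRA; closes nothing.

Kim's Prop. 3.15 (Compositio 143 (2007), p. 56) splits the layer `H_n = H_n[ω⁻_n] + H_n[ω̃⁺_n]` because «`ω⁻_n(X)` and `ω̃⁺_n(X)` are
prime to each other» — over `Λ = ℤ_p⟦T⟧` the two half products of cyclotomic polynomials generate an ideal of FINITE index, not the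
unit ideal; at a finite level `2^J` this index is the `p`-power torsion that the level-raising `J ↦ J + ν` of the cofree calculus
(`…PlusDualLayerAlgebra.nsmul_image_torsionBy_ker_succ_eq`) absorbs. This file quantifies it, with the tree's
`cyclotomicOmega p n = (T+1)^{pⁿ} − 1`, `cyclotomicOmegaPlus p n = ∏_{1≤2k≤n} Φ_{p^{2k}}(1+T)`, `cyclotomicOmegaMinus p n =
∏_{1≤2k−1≤n} Φ_{p^{2k−1}}(1+T)` (`Literature/…/PlusMinusPAdicLFunction`, `T·ω⁺·ω⁻ = ω_n`):

* §1 `natCast_mem_span_X_cyclotomic_comp` (`p ∈ (T, Φ_{p^{k+1}}(1+T))`, as `Φ_{p^{k+1}}(1) = p`),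
  `natCast_mem_span_cyclotomic_comp_pair` (`p ∈ (Φ_{p^{a+1}}(1+T), Φ_{p^{b+1}}(1+T))` for `a ≠ b`: `Φ_{p^{b+1}}(Y) = ∑_{j<p} Y^{jp^b} ≡ p`
  modulo `Y^{p^{a+1}} − 1`), the product rule `mul_mem_span_pair_mul` and its `Finset` form;
* §2 **`pow_mem_span_X_mul_cyclotomicOmegaPlus_cyclotomicOmegaMinus`: `p^{(n/2+1)·((n+1)/2)} ∈ (T·ω̃⁺_n, ω̃⁻_n) ⊆ ℤ[T]`** and the mirror
  `p^{((n+1)/2+1)·(n/2)} ∈ (T·ω̃⁻_n, ω̃⁺_n)`;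
* §3 over `ℤ_p`: `aeval T P = ↑(P.map ℤ→ℤ_p)` in `Λ` (`aeval_X_eq_coe_map`, the bridge to the transposes of `…PlusDualLayerToolkit`);
  **`T·ω̃⁺_n`, `ω̃⁻_n`, `ω̃⁺_n`, `T·ω̃⁻_n` are DISTINGUISHED** (monic divisors of the distinguished `ω_n`, `isDistinguishedAt_of_mul_eq`).

HONEST FRAMING: closes nothing; ISO / `hdual_Alt` NOT proved here; 23110 NOT proved; BSD is not proved by any of this.
References: [BDKim2007] Prop. 3.15 (proof p. 56: «Since `ω⁻_n(X)` and `ω̃⁺_n(X)` are prime to each other …»); [Pollack2003] §6.5 (the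
polynomials `ω_n^±`); [Washington1997] §7.1, Lemma 1.4 / Prop. 2.8 (`Φ_{pⁿ}(1) = p`).
-/

set_option autoImplicit false
-- D-0017: single-problem summit, so `Summit.BirchSwinnertonDyer.BirchSwinnertonDyer.…` repeats a namespace BY DESIGN.
set_option linter.dupNamespace false

noncomputable section

open scoped Classical
open Polynomial Finset Literature.NumberTheory.EllipticCurves

namespace Summit.BirchSwinnertonDyer.BirchSwinnertonDyer.Theorems.ResidualThetaLayer.PlusDual

/-! ## §1 Pairwise Bezout relations between `T` and the `Φ_{p^k}(1+T)` -/

section Pairwise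

variable {R : Type*} [CommRing R]

/-- Product rule for two-generator ideals sharing a generator: `r₁ ∈ (f, g₁)`, `r₂ ∈ (f, g₂)` ⟹ `r₁ r₂ ∈ (f, g₁ g₂)`. [folklore] -/
theorem mul_mem_span_pair_mul {f g₁ g₂ r₁ r₂ : R} (h₁ : r₁ ∈ Ideal.span {f, g₁}) (h₂ : r₂ ∈ Ideal.span {f, g₂}) :
    r₁ * r₂ ∈ Ideal.span {f, g₁ * g₂} := by
  rw [Ideal.mem_span_pair] at h₁ h₂ ⊢
  obtain ⟨a₁, b₁, rfl⟩ := h₁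
  obtain ⟨a₂, b₂, rfl⟩ := h₂
  exact ⟨a₁ * (a₂ * f + b₂ * g₂) + b₁ * g₁ * a₂, b₁ * b₂, by ring⟩

/-- `Finset` form of the product rule: `r ∈ (f, g_j)` for all `j ∈ J` ⟹ `r^{#J} ∈ (f, ∏_{j∈J} g_j)`. [folklore] -/
theorem pow_card_mem_span_pair_prod {ι : Type*} (J : Finset ι) {f r : R} {g : ι → R}
    (h : ∀ j ∈ J, r ∈ Ideal.span {f, g j}) : r ^ J.card ∈ Ideal.span {f, ∏ j ∈ J, g j} := by
  induction J using Finset.induction_on with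
  | empty =>
    rw [card_empty, pow_zero, prod_empty]
    exact Ideal.subset_span (by simp)
  | insert a J ha ih =>
    rw [card_insert_of_notMem ha, pow_succ', prod_insert ha]
    exact mul_mem_span_pair_mul (h a (mem_insert_self a J)) (ih fun j hj ↦ h j (mem_insert_of_mem hj))

variable (p : ℕ) [hp : Fact p.Prime]

/-- **`p ∈ (T, Φ_{p^{k+1}}(1+T))` in `ℤ[T]`**: `Φ_{p^{k+1}}(1+T) ≡ Φ_{p^{k+1}}(1) = p (mod T)`.
[cite: Washington1997, §7.1 and Lemma 1.4 (`Φ_{pⁿ}(1) = p`)] -/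
theorem natCast_mem_span_X_cyclotomic_comp (k : ℕ) :
    (p : ℤ[X]) ∈ Ideal.span {(X : ℤ[X]), (cyclotomic (p ^ (k + 1)) ℤ).comp (X + 1)} := by
  set Q : ℤ[X] := (cyclotomic (p ^ (k + 1)) ℤ).comp (X + 1) with hQ
  have h0 : Q.eval 0 = (p : ℤ) := by
    rw [hQ, eval_comp, eval_add, eval_X, eval_one, zero_add, eval_one_cyclotomic_prime_pow (R := ℤ)]
  have hdvd : (X : ℤ[X]) ∣ Q - C (p : ℤ) := by
    rw [X_dvd_iff, coeff_sub, coeff_C_zero, ← h0, coeff_zero_eq_eval_zero, sub_self]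
  obtain ⟨A, hA⟩ := hdvd
  rw [Ideal.mem_span_pair]
  refine ⟨-A, 1, ?_⟩
  have e : (C (p : ℤ) : ℤ[X]) = (p : ℤ[X]) := map_natCast C p
  rw [← e]
  linear_combination hA

/-- **`p ∈ (Φ_{p^{a+1}}(Y), Φ_{p^{b+1}}(Y))` in `ℤ[Y]` for `a < b`**: `Φ_{p^{b+1}}(Y) = ∑_{j<p} (Y^{p^b})ʲ` and `Y^{p^b} ≡ 1` modulo
`Y^{p^{a+1}} − 1`, a multiple of `Φ_{p^{a+1}}(Y)`. [cite: Washington1997, Lemma 1.4 and §7.1] -/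
theorem natCast_mem_span_cyclotomic_pair_of_lt {a b : ℕ} (hab : a < b) :
    (p : ℤ[X]) ∈ Ideal.span {cyclotomic (p ^ (a + 1)) ℤ, cyclotomic (p ^ (b + 1)) ℤ} := by
  have hprime : p.Prime := hp.out
  -- `Φ_{p^{a+1}} ∣ Y^{p^b} − 1`
  have hdvd1 : cyclotomic (p ^ (a + 1)) ℤ ∣ (X : ℤ[X]) ^ p ^ b - 1 := by
    refine (cyclotomic.dvd_X_pow_sub_one (p ^ (a + 1)) ℤ).trans ?_
    obtain ⟨c, hc⟩ : p ^ (a + 1) ∣ p ^ b := pow_dvd_pow p hab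
    have := sub_dvd_pow_sub_pow ((X : ℤ[X]) ^ p ^ (a + 1)) 1 c
    rwa [one_pow, ← pow_mul, ← hc] at this
  -- `Φ_{p^{b+1}} − p = ∑_{j<p} ((Y^{p^b})^j − 1)` is a multiple of `Y^{p^b} − 1`
  have hdvd2 : (X : ℤ[X]) ^ p ^ b - 1 ∣ cyclotomic (p ^ (b + 1)) ℤ - (p : ℤ[X]) := by
    rw [cyclotomic_prime_pow_eq_geom_sum hprime]
    have e : (∑ i ∈ range p, ((X : ℤ[X]) ^ p ^ b) ^ i) - (p : ℤ[X]) = ∑ i ∈ range p, (((X : ℤ[X]) ^ p ^ b) ^ i - 1) := by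
      rw [sum_sub_distrib, sum_const, card_range, nsmul_eq_mul, mul_one]
    rw [e]
    exact dvd_sum fun i _ ↦ by simpa using sub_dvd_pow_sub_pow ((X : ℤ[X]) ^ p ^ b) 1 i
  obtain ⟨A, hA⟩ := hdvd1.trans hdvd2
  rw [Ideal.mem_span_pair]
  exact ⟨-A, 1, by linear_combination hA⟩

/-- `p ∈ (Φ_{p^{a+1}}(Y), Φ_{p^{b+1}}(Y))` for `a ≠ b`. [cite: Washington1997, Lemma 1.4 and §7.1] -/
theorem natCast_mem_span_cyclotomic_pair {a b : ℕ} (hab : a ≠ b) :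
    (p : ℤ[X]) ∈ Ideal.span {cyclotomic (p ^ (a + 1)) ℤ, cyclotomic (p ^ (b + 1)) ℤ} := by
  rcases lt_or_gt_of_ne hab with h | h
  · exact natCast_mem_span_cyclotomic_pair_of_lt p h
  · rw [Ideal.span_pair_comm]; exact natCast_mem_span_cyclotomic_pair_of_lt p h

/-- Transport of a two-generator membership along `P ↦ P(1+T)`: `r ∈ (F, G)` with `r` a constant ⟹ `r ∈ (F(1+T), G(1+T))`. [folklore] -/
theorem natCast_mem_span_pair_comp {F G : ℤ[X]} {r : ℕ} (h : (r : ℤ[X]) ∈ Ideal.span {F, G}) (Q : ℤ[X]) :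
    (r : ℤ[X]) ∈ Ideal.span {F.comp Q, G.comp Q} := by
  rw [Ideal.mem_span_pair] at h ⊢
  obtain ⟨A, B, hAB⟩ := h
  refine ⟨A.comp Q, B.comp Q, ?_⟩
  have := congrArg (fun P : ℤ[X] ↦ P.comp Q) hAB
  simpa only [add_comp, mul_comp, natCast_comp] using this

/-- **`p ∈ (Φ_{p^{a+1}}(1+T), Φ_{p^{b+1}}(1+T))` in `ℤ[T]` for `a ≠ b`.** [cite: Washington1997, Lemma 1.4 and §7.1] -/
theorem natCast_mem_span_cyclotomic_comp_pair {a b : ℕ} (hab : a ≠ b) :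
    (p : ℤ[X]) ∈ Ideal.span {(cyclotomic (p ^ (a + 1)) ℤ).comp (X + 1), (cyclotomic (p ^ (b + 1)) ℤ).comp (X + 1)} :=
  natCast_mem_span_pair_comp (natCast_mem_span_cyclotomic_pair p hab) (X + 1)

end Pairwise

/-! ## §2 Bezout for the half products `T·ω̃⁺_n`, `ω̃⁻_n` -/

section Bezout

variable (p : ℕ) [hp : Fact p.Prime]

/-- `p^{n/2} ∈ (Φ_{p^{2j−1}}(1+T), ω̃⁺_n)` for every odd index `2j − 1 ≥ 1`: the factors `Φ_{p^{2k}}(1+T)` (`1 ≤ k ≤ n/2`) of `ω̃⁺_n`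
have even exponent, prime to the odd one. [cite: BDKim2007, Prop. 3.15 (proof, p. 56)] -/
theorem pow_mem_span_cyclotomicOdd_cyclotomicOmegaPlus (n j : ℕ) (hj : 1 ≤ j) :
    (p : ℤ[X]) ^ (n / 2) ∈ Ideal.span {(cyclotomic (p ^ (2 * j - 1)) ℤ).comp (X + 1), cyclotomicOmegaPlus p n} := by
  have h := pow_card_mem_span_pair_prod (R := ℤ[X]) (Icc 1 (n / 2)) (f := (cyclotomic (p ^ (2 * j - 1)) ℤ).comp (X + 1))
    (r := (p : ℤ[X])) (g := fun k ↦ (cyclotomic (p ^ (2 * k)) ℤ).comp (X + 1)) fun k hk ↦ by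
      have hk1 : 1 ≤ k := (mem_Icc.mp hk).1
      have e1 : 2 * j - 1 = (2 * j - 2) + 1 := by omega
      have e2 : 2 * k = (2 * k - 1) + 1 := by omega
      rw [e1, e2]
      exact natCast_mem_span_cyclotomic_comp_pair p (by omega)
  rwa [Nat.card_Icc, show n / 2 + 1 - 1 = n / 2 from by omega] at h

/-- **BEZOUT `p^{(n/2+1)·((n+1)/2)} ∈ (T·ω̃⁺_n, ω̃⁻_n) ⊆ ℤ[T]`**: each odd factor `Φ_{p^{2j−1}}(1+T)` of `ω̃⁻_n` (`1 ≤ j ≤ (n+1)/2`) sees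
`p ∈ (·, T)` and `p^{n/2} ∈ (·, ω̃⁺_n)`; multiply up. (Kim: «`ω⁻_n` and `ω̃⁺_n` are prime to each other» — over `Λ` up to this explicit
`p`-power.) [cite: BDKim2007, Prop. 3.15 (proof, p. 56)] [cite: Pollack2003, §6.5] -/
theorem pow_mem_span_X_mul_cyclotomicOmegaPlus_cyclotomicOmegaMinus (n : ℕ) :
    (p : ℤ[X]) ^ ((n / 2 + 1) * ((n + 1) / 2)) ∈ Ideal.span {X * cyclotomicOmegaPlus p n, cyclotomicOmegaMinus p n} := by
  -- for each odd factor: `p^{n/2+1} ∈ (T·ω̃⁺, Φ_odd)`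
  have hodd : ∀ j ∈ Icc 1 ((n + 1) / 2),
      (p : ℤ[X]) ^ (n / 2 + 1) ∈ Ideal.span {X * cyclotomicOmegaPlus p n, (cyclotomic (p ^ (2 * j - 1)) ℤ).comp (X + 1)} := by
    intro j hj
    have hj1 : 1 ≤ j := (mem_Icc.mp hj).1
    have e1 : 2 * j - 1 = (2 * j - 2) + 1 := by omega
    have h1 : (p : ℤ[X]) ∈ Ideal.span {(cyclotomic (p ^ (2 * j - 1)) ℤ).comp (X + 1), (X : ℤ[X])} := by
      rw [Ideal.span_pair_comm, e1]; exact natCast_mem_span_X_cyclotomic_comp p (2 * j - 2)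
    have h2 := pow_mem_span_cyclotomicOdd_cyclotomicOmegaPlus p n j hj1
    rw [Ideal.span_pair_comm, pow_succ']
    exact mul_mem_span_pair_mul h1 h2
  have h := pow_card_mem_span_pair_prod (R := ℤ[X]) (Icc 1 ((n + 1) / 2)) hodd
  rwa [Nat.card_Icc, show (n + 1) / 2 + 1 - 1 = (n + 1) / 2 from by omega, ← pow_mul] at h

/-- The mirror Bezout relation `p^{((n+1)/2+1)·(n/2)} ∈ (T·ω̃⁻_n, ω̃⁺_n)`. [cite: BDKim2007, Prop. 3.15 (proof, p. 56)] -/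
theorem pow_mem_span_X_mul_cyclotomicOmegaMinus_cyclotomicOmegaPlus (n : ℕ) :
    (p : ℤ[X]) ^ (((n + 1) / 2 + 1) * (n / 2)) ∈ Ideal.span {X * cyclotomicOmegaMinus p n, cyclotomicOmegaPlus p n} := by
  have heven : ∀ k ∈ Icc 1 (n / 2),
      (p : ℤ[X]) ^ ((n + 1) / 2 + 1) ∈ Ideal.span {X * cyclotomicOmegaMinus p n, (cyclotomic (p ^ (2 * k)) ℤ).comp (X + 1)} := by
    intro k hk
    have hk1 : 1 ≤ k := (mem_Icc.mp hk).1
    have e2 : 2 * k = (2 * k - 1) + 1 := by omega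
    have h1 : (p : ℤ[X]) ∈ Ideal.span {(cyclotomic (p ^ (2 * k)) ℤ).comp (X + 1), (X : ℤ[X])} := by
      rw [Ideal.span_pair_comm, e2]; exact natCast_mem_span_X_cyclotomic_comp p (2 * k - 1)
    have h2 : (p : ℤ[X]) ^ ((n + 1) / 2) ∈
        Ideal.span {(cyclotomic (p ^ (2 * k)) ℤ).comp (X + 1), cyclotomicOmegaMinus p n} := by
      have h := pow_card_mem_span_pair_prod (R := ℤ[X]) (Icc 1 ((n + 1) / 2))
        (f := (cyclotomic (p ^ (2 * k)) ℤ).comp (X + 1)) (r := (p : ℤ[X]))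
        (g := fun j ↦ (cyclotomic (p ^ (2 * j - 1)) ℤ).comp (X + 1)) fun j hj ↦ by
          have hj1 : 1 ≤ j := (mem_Icc.mp hj).1
          have e1 : 2 * j - 1 = (2 * j - 2) + 1 := by omega
          rw [e1, e2]
          exact natCast_mem_span_cyclotomic_comp_pair p (by omega)
      rwa [Nat.card_Icc, show (n + 1) / 2 + 1 - 1 = (n + 1) / 2 from by omega] at h
    rw [Ideal.span_pair_comm, pow_succ']
    exact mul_mem_span_pair_mul h1 h2
  have h := pow_card_mem_span_pair_prod (R := ℤ[X]) (Icc 1 (n / 2)) heven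
  rwa [Nat.card_Icc, show n / 2 + 1 - 1 = n / 2 from by omega, ← pow_mul] at h

end Bezout

/-! ## §3 Over `ℤ_p`: the half polynomials are distinguished; `aeval T` is the coercion `ℤ[T] → ℤ_p[T] → Λ` -/

section PadicInt

variable (p : ℕ) [hp : Fact p.Prime]

/-- `aeval T P = ↑(P.map (ℤ → ℤ_p))` in `Λ = ℤ_p⟦T⟧` for `P ∈ ℤ[T]` (both are the `ℤ`-algebra map sending `T ↦ T`); this bridges the
transposes `toDual_aeval_X_smul` of `…PlusDualLayerToolkit` with the distinguished generators below. [folklore] -/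
theorem aeval_X_eq_coe_map (P : ℤ[X]) :
    Polynomial.aeval (PowerSeries.X : PowerSeries ℤ_[p]) P = ((P.map (Int.castRingHom ℤ_[p]) : ℤ_[p][X]) : PowerSeries ℤ_[p]) := by
  induction P using Polynomial.induction_on' with
  | add P Q hP hQ => simp [hP, hQ]
  | monomial n a =>
    simp only [aeval_monomial, Polynomial.map_monomial, Polynomial.coe_monomial, eq_intCast]
    rw [PowerSeries.X_pow_eq, show ((a : ℤ) : PowerSeries ℤ_[p]) = PowerSeries.C (a : ℤ_[p]) from
      (map_intCast (PowerSeries.C (R := ℤ_[p])) a).symm, ← PowerSeries.monomial_zero_eq_C_apply,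
      PowerSeries.monomial_mul_monomial, zero_add, mul_one]

/-- `ω_n = (T+1)^{pⁿ} − 1` base-changed to `ℤ_p` is the tree's distinguished polynomial
(`Kato2004.IwasawaH1Exists.isDistinguishedAt_omega`). [cite: Washington1997, §7.1] -/
theorem map_cyclotomicOmega (n : ℕ) :
    (cyclotomicOmega p n).map (Int.castRingHom ℤ_[p]) = (X + 1 : ℤ_[p][X]) ^ p ^ n - 1 := by
  rw [cyclotomicOmega, Polynomial.map_sub, Polynomial.map_pow, Polynomial.map_add, Polynomial.map_X, Polynomial.map_one]

/-- `ω_n ↦` a distinguished polynomial of degree `pⁿ` over `ℤ_p`. [cite: Washington1997, §7.1] -/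
theorem isDistinguishedAt_map_cyclotomicOmega (n : ℕ) :
    ((cyclotomicOmega p n).map (Int.castRingHom ℤ_[p])).IsDistinguishedAt (IsLocalRing.maximalIdeal ℤ_[p]) := by
  rw [map_cyclotomicOmega]; exact Kato2004.IwasawaH1Exists.isDistinguishedAt_omega p n

/-- **`T·ω̃⁺_n` and `ω̃⁻_n` are distinguished over `ℤ_p`** (monic divisors of `ω_n = T·ω̃⁺_n·ω̃⁻_n`).
[cite: Washington1997, §7.1] [cite: Pollack2003, §6.5] -/
theorem isDistinguishedAt_map_X_mul_cyclotomicOmegaPlus_and_Minus (n : ℕ) :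
    ((X * cyclotomicOmegaPlus p n).map (Int.castRingHom ℤ_[p])).IsDistinguishedAt (IsLocalRing.maximalIdeal ℤ_[p]) ∧
      ((cyclotomicOmegaMinus p n).map (Int.castRingHom ℤ_[p])).IsDistinguishedAt (IsLocalRing.maximalIdeal ℤ_[p]) := by
  have hprod : (X * cyclotomicOmegaPlus p n).map (Int.castRingHom ℤ_[p]) * (cyclotomicOmegaMinus p n).map (Int.castRingHom ℤ_[p]) =
      (cyclotomicOmega p n).map (Int.castRingHom ℤ_[p]) := by
    rw [← Polynomial.map_mul, X_mul_cyclotomicOmegaPlus_mul_cyclotomicOmegaMinus]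
  have hA : ((X * cyclotomicOmegaPlus p n).map (Int.castRingHom ℤ_[p])).Monic :=
    (monic_X.mul (monic_cyclotomicOmegaPlus p n)).map _
  have hB : ((cyclotomicOmegaMinus p n).map (Int.castRingHom ℤ_[p])).Monic := (monic_cyclotomicOmegaMinus p n).map _
  exact ⟨isDistinguishedAt_of_mul_eq (isDistinguishedAt_map_cyclotomicOmega p n) hA hB hprod,
    isDistinguishedAt_of_mul_eq' (isDistinguishedAt_map_cyclotomicOmega p n) hA hB hprod⟩

/-- **`T·ω̃⁻_n` and `ω̃⁺_n` are distinguished over `ℤ_p`.** [cite: Washington1997, §7.1] [cite: Pollack2003, §6.5] -/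
theorem isDistinguishedAt_map_X_mul_cyclotomicOmegaMinus_and_Plus (n : ℕ) :
    ((X * cyclotomicOmegaMinus p n).map (Int.castRingHom ℤ_[p])).IsDistinguishedAt (IsLocalRing.maximalIdeal ℤ_[p]) ∧
      ((cyclotomicOmegaPlus p n).map (Int.castRingHom ℤ_[p])).IsDistinguishedAt (IsLocalRing.maximalIdeal ℤ_[p]) := by
  have hprod : (X * cyclotomicOmegaMinus p n).map (Int.castRingHom ℤ_[p]) * (cyclotomicOmegaPlus p n).map (Int.castRingHom ℤ_[p]) =
      (cyclotomicOmega p n).map (Int.castRingHom ℤ_[p]) := by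
    rw [← Polynomial.map_mul, ← X_mul_cyclotomicOmegaPlus_mul_cyclotomicOmegaMinus]; ring_nf
  have hA : ((X * cyclotomicOmegaMinus p n).map (Int.castRingHom ℤ_[p])).Monic :=
    (monic_X.mul (monic_cyclotomicOmegaMinus p n)).map _
  have hB : ((cyclotomicOmegaPlus p n).map (Int.castRingHom ℤ_[p])).Monic := (monic_cyclotomicOmegaPlus p n).map _
  exact ⟨isDistinguishedAt_of_mul_eq (isDistinguishedAt_map_cyclotomicOmega p n) hA hB hprod,
    isDistinguishedAt_of_mul_eq' (isDistinguishedAt_map_cyclotomicOmega p n) hA hB hprod⟩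

/-- Degrees: `deg(T·ω̃⁺_n) + deg ω̃⁻_n = pⁿ`. [cite: Pollack2003, §6.5] -/
theorem natDegree_X_mul_cyclotomicOmegaPlus_add (n : ℕ) :
    (X * cyclotomicOmegaPlus p n).natDegree + (cyclotomicOmegaMinus p n).natDegree = p ^ n := by
  have h := congrArg Polynomial.natDegree (X_mul_cyclotomicOmegaPlus_mul_cyclotomicOmegaMinus (p := p) n)
  rw [(monic_X.mul (monic_cyclotomicOmegaPlus p n)).natDegree_mul (monic_cyclotomicOmegaMinus p n)] at h
  rw [h, cyclotomicOmega]
  have h1 : ((X + 1 : ℤ[X]) ^ p ^ n).natDegree = p ^ n := by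
    rw [← C_1, (monic_X_add_C (1 : ℤ)).natDegree_pow, natDegree_X_add_C, mul_one]
  rw [natDegree_sub_eq_left_of_natDegree_lt (by rw [natDegree_one, h1]; exact pow_pos hp.out.pos n), h1]

end PadicInt

end Summit.BirchSwinnertonDyer.BirchSwinnertonDyer.Theorems.ResidualThetaLayer.PlusDual

end
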